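import Literature.Algebra.Homology.RepExtGroupCohomologyClasses
import Mathlib.RepresentationTheory.Homological.GroupCohomology.LongExactSequence
import HarnessLib

/-!
# `Extⁿ_{Rep k G}(k, A) ≃+ Hⁿ(G, A)` commutes with the connecting homomorphisms

Topic `Algebra/Homology`; namespace `Literature.Algebra.Homology.RepExt`.  Theorems only; no definition,
no named fact, no instance, no `sorry`.  Sequel of `RepExtGroupCohomologyClasses` (explicit cocycle
classes of `Extⁿ(k, A) ≃+ Hⁿ(Hom(P•, A))`, the short exact sequence `homSC P S`).

For a short exact sequence `S : 0 → X₁ → X₂ → X₃ → 0` in `Rep k G` the dictionary intertwines the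
Yoneda connecting map `z ↦ z ∘ [S]` on `Ext*_{Rep k G}(k, –)` (Mathlib `ShortExact.extClass`) with
Mathlib's `groupCohomology.δ`:

* `exists_snake_hom`: the snake-lemma representatives attached to a cocycle `p_{Qᵢ} ≫ c̄ : Pᵢ → X₃`
  (a lift `Pᵢ → X₂` by projectivity, the cochain `e : Pᵢ₊₁ → X₁` with `e ≫ f = d ≫ lift`, its
  factorisation `ē : Qᵢ₊₁ → X₁`) form a morphism of short exact sequences
  `(0 → Qᵢ₊₁ → Pᵢ → Qᵢ → 0) ⟶ S`, whence `[Sᵢ] ∘ ē = c̄ ∘ [S]` (`extClass_naturality`);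
* **`extTrivialAddEquivResolutionHomology_comp_extClass(_zero)`**: `E(z ∘ [S]) = δ_{Hom(P•,S)}(E z)` for
  `E : Ext ≃+ H(Hom(P•, –))` and ANY projective resolution `P` (Mathlib's concrete `δ_apply` on one side,
  the Yoneda computation `Δₙ(y) ∘ [S] = Δₙ(y ∘ [S])`, `iterShift_comp_one`, on the other);
* `resolutionIso_hom_δ`: the tree's `resolutionIso : Hⁿ(G, A) ≅ Hⁿ(Hom(P•, A))` commutes with `δ`
  (naturality of `δ` for the morphism of short exact sequences of cochain complexes
  `inhomogeneousCochains(S) ⟶ Hom(P•, S)`);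
* **`extTrivialAddEquivGroupCohomology_comp_extClass`**, `…_zero`, `…_one_comp_extClass`:
  `E_{X₁}(z ∘ [S]) = groupCohomology.δ hS n (n+1) (E_{X₃} z)` for `E = extTrivialAddEquivGroupCohomology`.

Written for Route A of crux `stmt-BirchSwinnertonDyer-19295` (cell `bsd-schneider-ideate`, seat
door-c4 gen 14): long exact sequences cross the dictionary (Milne I Lemma 1.9 / Thm 1.8 webs), and the
change-of-group compatibility (sequel) is proved by dimension shifting from degree `0` with this file.
HONEST FRAMING: homological algebra only.

## References
* C. A. Weibel, *An introduction to homological algebra* (1994), §1.3 (snake lemma), §2.4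
  (Exercise 2.4.3), Theorem 2.7.6. [Weibel1994]
* K. S. Brown, *Cohomology of Groups*, GTM 87 (1982), III §1, III (6.1) (long exact sequence).
  [Brown1982CohomologyGroups]
-/

noncomputable section

universe u

namespace Literature.Algebra.Homology

namespace RepExt

open CategoryTheory CategoryTheory.Limits CategoryTheory.Abelian

variable {k G : Type u} [CommRing k] [Group G]

/-! ## §3 The dictionary commutes with the connecting homomorphisms of `Hom(P•, S)` -/

section Delta

variable (P : ProjectiveResolution (Rep.trivial k G k)) {S : ShortComplex (Rep.{u} k G)}
  (hS : S.ShortExact)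

/-- The snake-lemma representatives attached to a cocycle `c = p_{Qᵢ} ≫ cq : Pᵢ ⟶ X₃`: a lift
`cl : Pᵢ ⟶ X₂` (projectivity), the cochain `e : Pᵢ₊₁ ⟶ X₁` with `e ≫ f = d ≫ cl`, its factorisation
`ē : Qᵢ₊₁ ⟶ X₁`, and the resulting morphism of short exact sequences
`(0 → Qᵢ₊₁ → Pᵢ → Qᵢ → 0) ⟶ S`. [cite: Weibel1994, §1.3 (snake lemma)] -/
theorem exists_snake_hom (i : ℕ) (cq : P.complex.opcycles i ⟶ S.X₃) :
    ∃ (cl : P.complex.X i ⟶ S.X₂) (e : P.complex.X (i + 1) ⟶ S.X₁) (ē : P.complex.opcycles (i + 1) ⟶ S.X₁)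
      (_ : LeftResolution.opcyclesSC P.complex i ⟶ S),
      cl ≫ S.g = P.complex.pOpcycles i ≫ cq ∧ e ≫ S.f = P.complex.d (i + 1) i ≫ cl ∧
        P.complex.pOpcycles (i + 1) ≫ ē = e ∧
        (LeftResolution.opcyclesSC_shortExact P.complex i (P.complex_exactAt_succ i)).extClass.comp
            (Ext.mk₀ ē) (add_zero 1) = (Ext.mk₀ cq).comp hS.extClass (zero_add 1) := by
  haveI := hS.mono_f
  haveI := hS.epi_g
  set cl := Projective.factorThru (P.complex.pOpcycles i ≫ cq) S.g with hcl
  have hclg : cl ≫ S.g = P.complex.pOpcycles i ≫ cq := Projective.factorThru_comp _ S.g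
  have hdcl : (P.complex.d (i + 1) i ≫ cl) ≫ S.g = 0 := by
    rw [Category.assoc, hclg, HomologicalComplex.d_pOpcycles_assoc, zero_comp]
  set e := hS.exact.lift _ hdcl with he
  have hef : e ≫ S.f = P.complex.d (i + 1) i ≫ cl := hS.exact.lift_f _ hdcl
  have hde : P.complex.d (i + 1 + 1) (i + 1) ≫ e = 0 := by
    rw [← cancel_mono S.f, Category.assoc, hef, HomologicalComplex.d_comp_d_assoc, zero_comp, zero_comp]
  set ē := P.complex.descOpcycles e (i + 1 + 1) (by simp) hde with hē
  have hpē : P.complex.pOpcycles (i + 1) ≫ ē = e := HomologicalComplex.p_descOpcycles _ _ _ _ _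
  let φ : LeftResolution.opcyclesSC P.complex i ⟶ S :=
    { τ₁ := ē
      τ₂ := cl
      τ₃ := cq
      comm₁₂ := by
        rw [← cancel_epi (P.complex.pOpcycles (i + 1)), ← Category.assoc, hpē, hef,
          HomologicalComplex.p_fromOpcycles_assoc]
      comm₂₃ := hclg }
  exact ⟨cl, e, ē, φ, hclg, hef, hpē, ShortComplex.ShortExact.extClass_naturality _ hS φ⟩

/-- **`E(z ∘ [S]) = δ (E z)` in positive degrees** for `E = Ext ≃+ H(Hom(P•, –))` and the connecting
homomorphism of `0 → Hom(P•, X₁) → Hom(P•, X₂) → Hom(P•, X₃) → 0`.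
[cite: Weibel1994, §2.4 (Exercise 2.4.3), Theorem 2.7.6][cite: Brown1982CohomologyGroups, III (6.1)] -/
theorem extTrivialAddEquivResolutionHomology_comp_extClass (n : ℕ)
    (z : Ext (Rep.trivial k G k) S.X₃ (n + 1)) :
    extTrivialAddEquivResolutionHomology P S.X₁ (n + 1 + 1)
        (z.comp hS.extClass (rfl : n + 1 + 1 = n + 1 + 1)) =
      (homSC_shortExact P hS).δ (n + 1) (n + 1 + 1) rfl
        (extTrivialAddEquivResolutionHomology P S.X₃ (n + 1) z) := by
  haveI := epi_aug P
  obtain ⟨ē₃, rfl⟩ := LeftResolution.exists_eq_inv_comp_iterShift P.complex S.X₃ (aug P) (d_comp_aug P)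
    (exact_aug P) P.complex_exactAt_succ
    (LeftResolution.ext_eq_zero_of_projective P.complex S.X₃ P.projective) n z
  obtain ⟨cq, rfl⟩ := (Ext.mk₀_bijective _ _).2 ē₃
  obtain ⟨cl, e, ē, φ, hclg, hef, hpē, hnat⟩ := exists_snake_hom P hS (n + 1) cq
  -- the connecting homomorphism of `Hom(P•, S)` on the representative `p ≫ cq`
  have hx₃ : (forget₂ (ModuleCat.{u} k) Ab).map ((homSC P S).X₃.d (n + 1) (n + 1 + 1))
      (P.complex.pOpcycles (n + 1) ≫ cq : P.complex.X (n + 1) ⟶ S.X₃) = 0 := by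
    change (P.complex.linearYonedaObj k S.X₃).d (n + 1) (n + 1 + 1) _ = 0
    rw [ResolutionComparison.linearYonedaObj_d_apply, HomologicalComplex.d_pOpcycles_assoc, zero_comp]
    rfl
  have hx₂ : (forget₂ (ModuleCat.{u} k) Ab).map ((homSC P S).g.f (n + 1)) cl =
      (P.complex.pOpcycles (n + 1) ≫ cq : P.complex.X (n + 1) ⟶ S.X₃) := by
    change (ResolutionComparison.postcomp P.complex S.g).f (n + 1) cl = _
    rw [ResolutionComparison.postcomp_f_apply, hclg]
  have hx₁ : (forget₂ (ModuleCat.{u} k) Ab).map ((homSC P S).f.f (n + 1 + 1)) e =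
      (forget₂ (ModuleCat.{u} k) Ab).map ((homSC P S).X₂.d (n + 1) (n + 1 + 1)) cl := by
    change (ResolutionComparison.postcomp P.complex S.f).f (n + 1 + 1) e =
      (P.complex.linearYonedaObj k S.X₂).d (n + 1) (n + 1 + 1) cl
    rw [ResolutionComparison.postcomp_f_apply, ResolutionComparison.linearYonedaObj_d_apply, hef]
  have hδ := (homSC_shortExact P hS).δ_apply (n + 1) (n + 1 + 1) rfl _ hx₃ cl hx₂ e hx₁ (n + 1 + 1 + 1)
    (by simp)
  -- the two classes under the dictionary
  have h₃ := extTrivialAddEquivResolutionHomology_symm_homologyπ P S.X₃ n cq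
    ((homSC P S).X₃.cyclesMk (P.complex.pOpcycles (n + 1) ≫ cq : P.complex.X (n + 1) ⟶ S.X₃) (n + 1 + 1)
      ((ComplexShape.up ℕ).next_eq' rfl) hx₃)
    (HomologicalComplex.i_cyclesMk ((homSC P S).X₃)
      (P.complex.pOpcycles (n + 1) ≫ cq : P.complex.X (n + 1) ⟶ S.X₃) (n + 1 + 1)
      ((ComplexShape.up ℕ).next_eq' rfl) hx₃)
  have hx₁' := (homSC_shortExact P hS).d_eq_zero_of_f_eq_d_apply (n + 1) (n + 1 + 1) cl e hx₁
    (n + 1 + 1 + 1)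
  have h₁ := extTrivialAddEquivResolutionHomology_symm_homologyπ P S.X₁ (n + 1) ē
    ((homSC P S).X₁.cyclesMk e (n + 1 + 1 + 1) (by simp) hx₁')
    ((HomologicalComplex.i_cyclesMk ((homSC P S).X₁) e (n + 1 + 1 + 1) (by simp) hx₁').trans hpē.symm)
  rw [AddEquiv.symm_apply_eq] at h₃ h₁
  rw [← h₃]
  change _ = ((forget₂ (ModuleCat.{u} k) Ab).map ((homSC_shortExact P hS).δ (n + 1) (n + 1 + 1) rfl))
    (((forget₂ (ModuleCat.{u} k) Ab).map ((homSC P S).X₃.homologyπ (n + 1))) _)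
  rw [hδ]
  refine Eq.trans ?_ h₁.symm
  congr 1
  -- the Yoneda computation: `(ι⁻¹ ∘ Δₙ([Sₙ] ∘ cq)) ∘ [S] = ι⁻¹ ∘ Δₙ₊₁([Sₙ₊₁] ∘ ē)`
  rw [Ext.comp_assoc _ _ _ (zero_add (n + 1)) rfl (by omega)]
  congr 1
  rw [LeftResolution.iterShift_comp_one P.complex P.complex_exactAt_succ
      (LeftResolution.ext_eq_zero_of_projective P.complex S.X₃ P.projective)
      (LeftResolution.ext_eq_zero_of_projective P.complex S.X₁ P.projective) hS.extClass n
      (by omega) rfl (by omega),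
    LeftResolution.iterShift_succ_apply, LeftResolution.shiftAddEquiv_apply]
  congr 1
  rw [Ext.comp_assoc _ _ _ (add_zero 1) (zero_add 1) (by omega), ← hnat]

/-- **`E(z ∘ [S]) = δ (E z)` from degree `0` to degree `1`** (same statement, bottom of the
induction). [cite: Weibel1994, §2.4 (Exercise 2.4.3), Theorem 2.7.6][cite: Brown1982CohomologyGroups, III (6.1)] -/
theorem extTrivialAddEquivResolutionHomology_comp_extClass_zero
    (z : Ext (Rep.trivial k G k) S.X₃ 0) :
    extTrivialAddEquivResolutionHomology P S.X₁ (0 + 1)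
        (z.comp hS.extClass (rfl : 0 + 1 = 0 + 1)) =
      (homSC_shortExact P hS).δ 0 (0 + 1) rfl (extTrivialAddEquivResolutionHomology P S.X₃ 0 z) := by
  haveI := epi_aug P
  obtain ⟨ē₃, rfl⟩ := LeftResolution.exists_eq_inv_comp_zero P.complex S.X₃ (aug P) (d_comp_aug P)
    (exact_aug P) z
  obtain ⟨cq, rfl⟩ := (Ext.mk₀_bijective _ _).2 ē₃
  obtain ⟨cl, e, ē, φ, hclg, hef, hpē, hnat⟩ := exists_snake_hom P hS 0 cq
  have hx₃ : (forget₂ (ModuleCat.{u} k) Ab).map ((homSC P S).X₃.d 0 (0 + 1))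
      (P.complex.pOpcycles 0 ≫ cq : P.complex.X 0 ⟶ S.X₃) = 0 := by
    change (P.complex.linearYonedaObj k S.X₃).d 0 (0 + 1) _ = 0
    rw [ResolutionComparison.linearYonedaObj_d_apply, HomologicalComplex.d_pOpcycles_assoc, zero_comp]
    rfl
  have hx₂ : (forget₂ (ModuleCat.{u} k) Ab).map ((homSC P S).g.f 0) cl =
      (P.complex.pOpcycles 0 ≫ cq : P.complex.X 0 ⟶ S.X₃) := by
    change (ResolutionComparison.postcomp P.complex S.g).f 0 cl = _
    rw [ResolutionComparison.postcomp_f_apply, hclg]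
  have hx₁ : (forget₂ (ModuleCat.{u} k) Ab).map ((homSC P S).f.f (0 + 1)) e =
      (forget₂ (ModuleCat.{u} k) Ab).map ((homSC P S).X₂.d 0 (0 + 1)) cl := by
    change (ResolutionComparison.postcomp P.complex S.f).f (0 + 1) e =
      (P.complex.linearYonedaObj k S.X₂).d 0 (0 + 1) cl
    rw [ResolutionComparison.postcomp_f_apply, ResolutionComparison.linearYonedaObj_d_apply, hef]
  have hδ := (homSC_shortExact P hS).δ_apply 0 (0 + 1) rfl _ hx₃ cl hx₂ e hx₁ (0 + 1 + 1) (by simp)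
  have h₃ := extTrivialAddEquivResolutionHomology_symm_homologyπ_zero P S.X₃ cq
    ((homSC P S).X₃.cyclesMk (P.complex.pOpcycles 0 ≫ cq : P.complex.X 0 ⟶ S.X₃) (0 + 1)
      ((ComplexShape.up ℕ).next_eq' rfl) hx₃)
    (HomologicalComplex.i_cyclesMk ((homSC P S).X₃)
      (P.complex.pOpcycles 0 ≫ cq : P.complex.X 0 ⟶ S.X₃) (0 + 1) ((ComplexShape.up ℕ).next_eq' rfl) hx₃)
  have hx₁' := (homSC_shortExact P hS).d_eq_zero_of_f_eq_d_apply 0 (0 + 1) cl e hx₁ (0 + 1 + 1)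
  have h₁ := extTrivialAddEquivResolutionHomology_symm_homologyπ P S.X₁ 0 ē
    ((homSC P S).X₁.cyclesMk e (0 + 1 + 1) (by simp) hx₁')
    ((HomologicalComplex.i_cyclesMk ((homSC P S).X₁) e (0 + 1 + 1) (by simp) hx₁').trans hpē.symm)
  rw [AddEquiv.symm_apply_eq] at h₃ h₁
  rw [← h₃]
  change _ = ((forget₂ (ModuleCat.{u} k) Ab).map ((homSC_shortExact P hS).δ 0 (0 + 1) rfl))
    (((forget₂ (ModuleCat.{u} k) Ab).map ((homSC P S).X₃.homologyπ 0)) _)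
  rw [hδ]
  refine Eq.trans ?_ h₁.symm
  congr 1
  -- the Yoneda computation: `(ι⁻¹ ∘ c̄) ∘ [S] = ι⁻¹ ∘ Δ₀([S₀] ∘ ē) = ι⁻¹ ∘ ([S₀] ∘ ē)`
  rw [LeftResolution.iterShift_zero_apply, Ext.comp_assoc _ _ _ (zero_add 0) (zero_add 1) (by omega),
    ← hnat]

end Delta

/-! ## §4 The dictionary commutes with `groupCohomology.δ` -/

section GroupCohomology

variable {S : ShortComplex (Rep.{u} k G)} (hS : S.ShortExact)

/-- The tree's comparison `Hⁿ(G, A) ≅ Hⁿ(Hom(P•, A))` is the map on homology of ONE cochain map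
`inhomogeneousCochains A ≅ Hom(bar•, A) → Hom(P•, A)` (natural in `A`).
[cite: Brown1982CohomologyGroups, III §1] -/
theorem resolutionIso_hom_eq (P : ProjectiveResolution (Rep.trivial k G k)) (A : Rep.{u} k G) (n : ℕ) :
    (ResolutionComparison.resolutionIso P A n).hom =
      HomologicalComplex.homologyMap ((groupCohomology.inhomogeneousCochainsIso A).hom ≫
        ResolutionComparison.precomp (ResolutionComparison.toBarHomotopyEquiv P).hom A) n := by
  rw [HomologicalComplex.homologyMap_comp]
  rfl

/-- **`resolutionIso` commutes with the connecting homomorphisms**: for every projective resolution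
`P`, `resolutionIso (groupCohomology.δ x) = δ_{Hom(P•,S)} (resolutionIso x)`.
[cite: Brown1982CohomologyGroups, III (6.1)] -/
theorem resolutionIso_hom_δ (P : ProjectiveResolution (Rep.trivial k G k)) (i j : ℕ) (hij : i + 1 = j)
    (x : groupCohomology S.X₃ i) :
    (ResolutionComparison.resolutionIso P S.X₁ j).hom (groupCohomology.δ hS i j hij x) =
      (homSC_shortExact P hS).δ i j hij ((ResolutionComparison.resolutionIso P S.X₃ i).hom x) := by
  -- the comparison chain maps, as a morphism of short exact sequences of cochain complexes
  let τ : ∀ A : Rep.{u} k G, (groupCohomology.cochainsFunctor k G).obj A ⟶ P.complex.linearYonedaObj k A :=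
    fun A => (groupCohomology.inhomogeneousCochainsIso A).hom ≫
      ResolutionComparison.precomp (ResolutionComparison.toBarHomotopyEquiv P).hom A
  have hτ : ∀ {A B : Rep.{u} k G} (f : A ⟶ B),
      τ A ≫ ResolutionComparison.postcomp P.complex f = (groupCohomology.cochainsFunctor k G).map f ≫ τ B := by
    intro A B f
    change ((groupCohomology.inhomogeneousCochainsIso A).hom ≫ ResolutionComparison.precomp _ A) ≫ _ =
      groupCohomology.cochainsMap (MonoidHom.id G) f ≫
        (groupCohomology.inhomogeneousCochainsIso B).hom ≫ ResolutionComparison.precomp _ B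
    rw [Category.assoc, ResolutionComparison.precomp_postcomp, ← Category.assoc,
      ResolutionComparison.inhomogeneousCochainsIso_hom_naturality, Category.assoc]
  let φ : S.map (groupCohomology.cochainsFunctor k G) ⟶ homSC P S :=
    { τ₁ := τ S.X₁
      τ₂ := τ S.X₂
      τ₃ := τ S.X₃
      comm₁₂ := hτ S.f
      comm₂₃ := hτ S.g }
  have nat := HomologicalComplex.HomologySequence.δ_naturality φ
    (groupCohomology.map_cochainsFunctor_shortExact hS) (homSC_shortExact P hS) i j hij
  have hR₁ : HomologicalComplex.homologyMap φ.τ₁ j = (ResolutionComparison.resolutionIso P S.X₁ j).hom :=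
    (resolutionIso_hom_eq P S.X₁ _).symm
  have hR₃ : HomologicalComplex.homologyMap φ.τ₃ i = (ResolutionComparison.resolutionIso P S.X₃ i).hom :=
    (resolutionIso_hom_eq P S.X₃ _).symm
  rw [hR₁, hR₃] at nat
  exact LinearMap.congr_fun (congrArg ModuleCat.Hom.hom nat) x

/-- Elementwise inverse form. [cite: Brown1982CohomologyGroups, III (6.1)] -/
theorem resolutionIso_inv_δ (P : ProjectiveResolution (Rep.trivial k G k)) (i j : ℕ) (hij : i + 1 = j)
    (w : (P.complex.linearYonedaObj k S.X₃).homology i) :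
    (ResolutionComparison.resolutionIso P S.X₁ j).inv ((homSC_shortExact P hS).δ i j hij w) =
      groupCohomology.δ hS i j hij ((ResolutionComparison.resolutionIso P S.X₃ i).inv w) := by
  have h := resolutionIso_hom_δ hS P i j hij ((ResolutionComparison.resolutionIso P S.X₃ i).inv w)
  have h3 : (ResolutionComparison.resolutionIso P S.X₃ i).hom
      ((ResolutionComparison.resolutionIso P S.X₃ i).inv w) = w :=
    LinearMap.congr_fun (congrArg ModuleCat.Hom.hom (ResolutionComparison.resolutionIso P S.X₃ i).inv_hom_id) w
  rw [h3] at h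
  rw [← h]
  change ((ResolutionComparison.resolutionIso P S.X₁ j).hom ≫
      (ResolutionComparison.resolutionIso P S.X₁ j).inv).hom _ = _
  rw [Iso.hom_inv_id]
  rfl

/-- **The dictionary intertwines connecting homomorphisms (positive degrees)**: for a short exact
sequence `S : 0 → X₁ → X₂ → X₃ → 0` in `Rep k G` and `z ∈ Extⁿ⁺¹(k, X₃)`,
`E_{X₁}(z ∘ [S]) = groupCohomology.δ (E_{X₃} z)` where `E = extTrivialAddEquivGroupCohomology` and
`[S] = hS.extClass`. [cite: Brown1982CohomologyGroups, III (6.1)][cite: Weibel1994, Theorem 2.7.6] -/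
theorem extTrivialAddEquivGroupCohomology_comp_extClass (n : ℕ) (z : Ext (Rep.trivial k G k) S.X₃ (n + 1)) :
    extTrivialAddEquivGroupCohomology S.X₁ (n + 1 + 1) (z.comp hS.extClass (rfl : n + 1 + 1 = n + 1 + 1)) =
      groupCohomology.δ hS (n + 1) (n + 1 + 1) rfl (extTrivialAddEquivGroupCohomology S.X₃ (n + 1) z) := by
  change (ResolutionComparison.resolutionIso (Rep.standardResolution k G) S.X₁ (n + 1 + 1)).inv
      (extTrivialAddEquivResolutionHomology (Rep.standardResolution k G) S.X₁ (n + 1 + 1)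
        (z.comp hS.extClass rfl)) =
    groupCohomology.δ hS (n + 1) (n + 1 + 1) rfl
      ((ResolutionComparison.resolutionIso (Rep.standardResolution k G) S.X₃ (n + 1)).inv
        (extTrivialAddEquivResolutionHomology (Rep.standardResolution k G) S.X₃ (n + 1) z))
  rw [extTrivialAddEquivResolutionHomology_comp_extClass _ hS n z, resolutionIso_inv_δ]

/-- **The dictionary intertwines connecting homomorphisms, degree `0 → 1`.**
[cite: Brown1982CohomologyGroups, III (6.1)][cite: Weibel1994, Theorem 2.7.6] -/
theorem extTrivialAddEquivGroupCohomology_comp_extClass_zero (z : Ext (Rep.trivial k G k) S.X₃ 0) :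
    extTrivialAddEquivGroupCohomology S.X₁ (0 + 1) (z.comp hS.extClass (rfl : 0 + 1 = 0 + 1)) =
      groupCohomology.δ hS 0 (0 + 1) rfl (extTrivialAddEquivGroupCohomology S.X₃ 0 z) := by
  change (ResolutionComparison.resolutionIso (Rep.standardResolution k G) S.X₁ (0 + 1)).inv
      (extTrivialAddEquivResolutionHomology (Rep.standardResolution k G) S.X₁ (0 + 1)
        (z.comp hS.extClass rfl)) =
    groupCohomology.δ hS 0 (0 + 1) rfl
      ((ResolutionComparison.resolutionIso (Rep.standardResolution k G) S.X₃ 0).inv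
        (extTrivialAddEquivResolutionHomology (Rep.standardResolution k G) S.X₃ 0 z))
  rw [extTrivialAddEquivResolutionHomology_comp_extClass_zero _ hS z, resolutionIso_inv_δ]

/-- **Clean degree-`1` form**: `E_{X₁}(z ∘ [S]) = groupCohomology.δ hS 0 1 (E_{X₃} z)` for `z ∈ Ext⁰`.
[cite: Brown1982CohomologyGroups, III (6.1)] -/
theorem extTrivialAddEquivGroupCohomology_one_comp_extClass (z : Ext (Rep.trivial k G k) S.X₃ 0) :
    extTrivialAddEquivGroupCohomology S.X₁ 1 (z.comp hS.extClass (zero_add 1)) =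
      groupCohomology.δ hS 0 1 rfl (extTrivialAddEquivGroupCohomology S.X₃ 0 z) :=
  extTrivialAddEquivGroupCohomology_comp_extClass_zero hS z

end GroupCohomology

end RepExt

end Literature.Algebra.Homology
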